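import Summits.KontsevichZagierPeriods.KontsevichZagierPeriods.Theorems.BetaCancellation.Negative.LoadBearing
import Literature.NumberTheory.Transcendental.KZMellinFibres
import Literature.NumberTheory.Transcendental.KZLogCalculusProofs

/-!
# `BetaCancellation` (stmt-KontsevichZagierPeriods-13633) — line `dirichlet-companion-to-pi`,
stub `stub_eulerRationalise`

The rationalising substitution of Euler's reflection integral, as ONE change-of-variables move
(rule (2) of the Kontsevich–Zagier calculus, `KZ.changeOfVariablesRel`). For natural numbers
`0 < p < q` the chart `Φ(s) = s^q / (1 + s^q)` maps the `s`-interval `(0,1)` bijectively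
(strictly increasing, inverse `s = (y/(1-y))^{1/q}`) onto the LOWER HALF `(0,1/2)` of the Beta
interval; its derivative is `Φ'(s) = q s^{q-1} / (1 + s^q)²`, and the Beta kernel with exponent
`a = p/q` pulls back to a RATIONAL integrand:
`Φ(s)^{a-1} (1 − Φ(s))^{-a} · Φ'(s) = (s^q)^{a-1} (1+s^q)^{1-a} · (1+s^q)^{a} · q s^{q-1}/(1+s^q)²
  = q s^{p-1} / (1 + s^q)`
(`1 − s^q/(1+s^q) = 1/(1+s^q)`, `(s^q)^{p/q-1} = s^{p-q}`; `ratz_kernel_identity`). Hence for the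
GIVEN representations `H = [(0,1/2), x^{p/q-1}(1-x)^{-p/q}]` and `G = [(0,1), q s^{p-1}/(1+s^q)]`
one has `[G] − [H] ∈ changeOfVariablesRel` (source `G`, chart `Φ`, image `H`), so
`KZ.Equivalent G H`, and `KZ.Equivalent H G` by symmetry (`stub_eulerRationalise`). The chart on
`ℝ¹ = Fin 1 → ℝ` is `x ↦ (fun _ => Φ (x 0))` with derivative the homothety `Φ'(x 0) • id`
(`|det| = Φ'(x 0) > 0`). Pattern of `…StubDirichletLinear.lean`; no definitions are introduced
(the chart and its derivative are written out), so that the file is a pure proof file.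

References: M. Kontsevich, D. Zagier, *Periods* (2001), §1.2 rule (2).
-/

noncomputable section

-- `Summit.KontsevichZagierPeriods.KontsevichZagierPeriods.…` is the tree's mandated layout (single-conjunct summit).
set_option linter.dupNamespace false

namespace Summit.KontsevichZagierPeriods.KontsevichZagierPeriods.BetaCancellationLine

open MeasureTheory Set
open Literature.NumberTheory.Transcendental
open Literature.NumberTheory.Transcendental.KZ
open Literature.ModelTheory.ExponentialFields (IsSemialgebraic)
open MvPolynomial (aeval X C)

/-! ## The pull-back identity -/

/-- **The pull-back identity** of the rationalising chart `Φ(s) = s^q/(1+s^q)` (Jacobian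
`q s^{q-1}/(1+s^q)²` included), for `0 < s` and `0 < p < q`:
`Φ(s)^{p/q-1} (1 − Φ(s))^{-p/q} · q s^{q-1}/(1+s^q)² = q s^{p-1}/(1+s^q)`
(`1 − s^q/(1+s^q) = (1+s^q)⁻¹`, `(s^q)^{p/q-1} = s^{p-q}`, `(1+s^q)^{p/q}/(1+s^q)^{p/q-1} = 1+s^q`,
`s^{p-q} s^{q-1} = s^{p-1}`; `rpow` algebra for positive bases). [folklore] -/
theorem ratz_kernel_identity {p q : ℕ} (hp : 0 < p) (hpq : p < q) {s : ℝ} (hs : 0 < s) :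
    (s ^ q / (1 + s ^ q)) ^ ((p:ℝ) / q - 1) * (1 - s ^ q / (1 + s ^ q)) ^ (-((p:ℝ) / q)) *
        ((q:ℝ) * s ^ (q - 1) / (1 + s ^ q) ^ 2) =
      (q:ℝ) * s ^ (p - 1) / (1 + s ^ q) := by
  have hq : 0 < q := lt_trans hp hpq
  have hq' : (q:ℝ) ≠ 0 := by exact_mod_cast hq.ne'
  have hu : 0 < s ^ q := pow_pos hs q
  have hv : 0 < 1 + s ^ q := by positivity
  -- `1 - u/(1+u) = (1+u)⁻¹`
  have h1 : 1 - s ^ q / (1 + s ^ q) = (1 + s ^ q)⁻¹ := by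
    rw [one_sub_div hv.ne', add_sub_cancel_right, one_div]
  -- `(u/(1+u))^(a-1) = u^(a-1) / (1+u)^(a-1)`
  have h2 : (s ^ q / (1 + s ^ q)) ^ ((p:ℝ) / q - 1) =
      (s ^ q) ^ ((p:ℝ) / q - 1) / (1 + s ^ q) ^ ((p:ℝ) / q - 1) :=
    Real.div_rpow hu.le hv.le _
  -- `((1+u)⁻¹)^(-a) = (1+u)^a`
  have h3 : ((1 + s ^ q)⁻¹) ^ (-((p:ℝ) / q)) = (1 + s ^ q) ^ ((p:ℝ) / q) := by
    rw [Real.inv_rpow hv.le, Real.rpow_neg hv.le, inv_inv]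
  -- `(s^q)^(a-1) = s^(p-q)` (real exponent)
  have h4 : (s ^ q) ^ ((p:ℝ) / q - 1) = s ^ ((p:ℝ) - q) := by
    rw [← Real.rpow_natCast s q, ← Real.rpow_mul hs.le]
    congr 1
    rw [mul_sub, mul_one, mul_div_assoc', mul_div_cancel_left₀ _ hq']
  -- `(1+u)^a / (1+u)^(a-1) = 1 + u`
  have h5 : (1 + s ^ q) ^ ((p:ℝ) / q) / (1 + s ^ q) ^ ((p:ℝ) / q - 1) = 1 + s ^ q := by
    rw [← Real.rpow_sub hv, sub_sub_cancel, Real.rpow_one]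
  -- `s^(p-q) * s^(q-1) = s^(p-1)`
  have h6 : s ^ ((p:ℝ) - q) * s ^ (q - 1) = s ^ (p - 1) := by
    rw [← Real.rpow_natCast s (q - 1), ← Real.rpow_natCast s (p - 1), ← Real.rpow_add hs,
      Nat.cast_pred hq, Nat.cast_pred hp]
    congr 1
    ring
  -- `(1+u)/(1+u)² = 1/(1+u)`
  have h7 : (1 + s ^ q) / (1 + s ^ q) ^ 2 = 1 / (1 + s ^ q) := by
    rw [pow_two, ← div_div, div_self hv.ne']
  calc (s ^ q / (1 + s ^ q)) ^ ((p:ℝ) / q - 1) * (1 - s ^ q / (1 + s ^ q)) ^ (-((p:ℝ) / q)) *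
        ((q:ℝ) * s ^ (q - 1) / (1 + s ^ q) ^ 2)
      = (s ^ q) ^ ((p:ℝ) / q - 1) *
          ((1 + s ^ q) ^ ((p:ℝ) / q) / (1 + s ^ q) ^ ((p:ℝ) / q - 1)) *
          ((q:ℝ) * s ^ (q - 1) / (1 + s ^ q) ^ 2) := by
        rw [h1, h2, h3]
        ring
    _ = (q:ℝ) * (s ^ ((p:ℝ) - q) * s ^ (q - 1)) * ((1 + s ^ q) / (1 + s ^ q) ^ 2) := by
        rw [h4, h5]
        ring
    _ = (q:ℝ) * s ^ (p - 1) / (1 + s ^ q) := by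
        rw [h6, h7, mul_one_div]

/-! ## The chart `Φ(s) = s^q/(1+s^q)` of `(0,1/2)` by `(0,1)` -/

/-- The derivative of `t ↦ t^q/(1+t^q)` at `s ≥ 0` is `q s^{q-1}/(1+s^q)²` (quotient rule). [folklore] -/
theorem ratz_hasDerivAt_chart (q : ℕ) {s : ℝ} (hs : 0 ≤ s) :
    HasDerivAt (fun t : ℝ => t ^ q / (1 + t ^ q)) ((q:ℝ) * s ^ (q - 1) / (1 + s ^ q) ^ 2) s := by
  have hv : 1 + s ^ q ≠ 0 := by positivity
  refine ((hasDerivAt_pow q s).fun_div ((hasDerivAt_pow q s).const_add 1) hv).congr_deriv ?_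
  ring

/-- The chart `x ↦ (fun _ => Φ (x 0))` of `ℝ¹` has derivative the homothety `Φ'(x 0) • id` at
every `x` with `x 0 ≥ 0`. [folklore] -/
theorem ratz_hasFDerivAt_chart (q : ℕ) {x : Fin 1 → ℝ} (hx : 0 ≤ x 0) :
    HasFDerivAt (fun y : Fin 1 → ℝ => fun _ : Fin 1 => (y 0) ^ q / (1 + (y 0) ^ q))
      (((q:ℝ) * (x 0) ^ (q - 1) / (1 + (x 0) ^ q) ^ 2) •
        ContinuousLinearMap.id ℝ (Fin 1 → ℝ)) x := by
  refine hasFDerivAt_pi'' fun i => ?_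
  obtain rfl : i = 0 := Fin.fin_one_eq_zero i
  have h := (ratz_hasDerivAt_chart q hx).comp_hasFDerivAt x (hasFDerivAt_apply (𝕜 := ℝ) 0 x)
  refine h.congr_fderiv (ContinuousLinearMap.ext fun v => ?_)
  simp

/-- `|det (c • id_{ℝ¹})| = c` for `c > 0`. [folklore] -/
theorem ratz_abs_det_smul_id {c : ℝ} (hc : 0 < c) :
    |(c • ContinuousLinearMap.id ℝ (Fin 1 → ℝ)).det| = c := by
  have : (c • ContinuousLinearMap.id ℝ (Fin 1 → ℝ)).det = c := by
    change LinearMap.det ((c • ContinuousLinearMap.id ℝ (Fin 1 → ℝ) :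
      (Fin 1 → ℝ) →L[ℝ] (Fin 1 → ℝ)) : (Fin 1 → ℝ) →ₗ[ℝ] (Fin 1 → ℝ)) = c
    rw [ContinuousLinearMap.toLinearMap_smul, ContinuousLinearMap.coe_id,
      LinearMap.det_smul, LinearMap.det_id, Module.finrank_fin_fun, pow_one, mul_one]
  rw [this, abs_of_pos hc]

/-- The chart is injective on `(0,1)` (`u ↦ u/(1+u)` is injective on `u > 0`, and so is
`s ↦ s^q` for `q ≠ 0`). [folklore] -/
theorem ratz_injOn_chart {q : ℕ} (hq : 0 < q) :
    InjOn (fun y : Fin 1 → ℝ => fun _ : Fin 1 => (y 0) ^ q / (1 + (y 0) ^ q))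
      {x : Fin 1 → ℝ | x 0 ∈ Set.Ioo (0:ℝ) 1} := by
  intro x hx y hy hxy
  have h0x : 0 < x 0 := hx.1
  have h0y : 0 < y 0 := hy.1
  have e := congrFun hxy 0
  dsimp only at e
  rw [div_eq_div_iff (by positivity) (by positivity)] at e
  have e' : x 0 ^ q = y 0 ^ q := by linear_combination e
  funext i
  obtain rfl : i = 0 := Fin.fin_one_eq_zero i
  exact (pow_left_inj₀ h0x.le h0y.le hq.ne').1 e'

/-- The chart maps `(0,1)` ONTO `(0,1/2)` (`s^q ∈ (0,1)` and `u/(1+u) < 1/2 ↔ u < 1`; inverse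
`s = (y/(1-y))^{1/q}`). [folklore] -/
theorem ratz_image_chart {q : ℕ} (hq : 0 < q) :
    (fun y : Fin 1 → ℝ => fun _ : Fin 1 => (y 0) ^ q / (1 + (y 0) ^ q)) ''
        {x : Fin 1 → ℝ | x 0 ∈ Set.Ioo (0:ℝ) 1} = {x : Fin 1 → ℝ | x 0 ∈ Set.Ioo (0:ℝ) (1/2)} := by
  ext y
  constructor
  · rintro ⟨x, hx, rfl⟩
    obtain ⟨h0, h1⟩ : 0 < x 0 ∧ x 0 < 1 := hx
    have hu : 0 < x 0 ^ q := pow_pos h0 q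
    have hu1 : x 0 ^ q < 1 := pow_lt_one₀ h0.le h1 hq.ne'
    show x 0 ^ q / (1 + x 0 ^ q) ∈ Ioo (0:ℝ) (1/2)
    refine ⟨by positivity, ?_⟩
    rw [div_lt_iff₀ (by positivity : (0:ℝ) < 1 + x 0 ^ q)]
    linarith
  · rintro ⟨hy0, hy1⟩
    have h1y : 0 < 1 - y 0 := by linarith
    have ht : 0 < y 0 / (1 - y 0) := div_pos hy0 h1y
    have ht1 : y 0 / (1 - y 0) < 1 := by
      rw [div_lt_one h1y]
      linarith
    have hty : y 0 / (1 - y 0) * (1 - y 0) = y 0 := div_mul_cancel₀ _ h1y.ne'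
    refine ⟨fun _ => (y 0 / (1 - y 0)) ^ ((q:ℝ)⁻¹), ?_, ?_⟩
    · show (y 0 / (1 - y 0)) ^ ((q:ℝ)⁻¹) ∈ Ioo (0:ℝ) 1
      exact ⟨Real.rpow_pos_of_pos ht _,
        Real.rpow_lt_one ht.le ht1 (inv_pos.2 (by exact_mod_cast hq))⟩
    · funext i
      obtain rfl : i = 0 := Fin.fin_one_eq_zero i
      show ((y 0 / (1 - y 0)) ^ ((q:ℝ)⁻¹)) ^ q / (1 + ((y 0 / (1 - y 0)) ^ ((q:ℝ)⁻¹)) ^ q) = y 0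
      rw [Real.rpow_inv_natCast_pow ht.le hq.ne', div_eq_iff (by positivity)]
      linear_combination hty

/-- The chart is a `ℚ`-semialgebraic map on any `ℚ`-semialgebraic set on which `x 0 ≥ 0` (its
single component is the quotient of the polynomials `X₀^q` and `1 + X₀^q`, the denominator
non-vanishing there). [folklore] -/
theorem ratz_isSemialgebraicMapOn_chart (q : ℕ) {s : Set (Fin 1 → ℝ)} (hs : IsSemialgebraic ℚ s)
    (hpos : ∀ x ∈ s, 0 ≤ x 0) :
    IsSemialgebraicMapOn ℚ s (fun y : Fin 1 → ℝ => fun _ : Fin 1 => (y 0) ^ q / (1 + (y 0) ^ q)) := by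
  refine IsSemialgebraicMapOn.of_forall hs fun _ => ?_
  refine (isSemialgebraicFunOn_aeval_div_aeval hs (X 0 ^ q) (1 + X 0 ^ q) fun x hx => ?_).congr
    fun x _ => ?_
  · have := hpos x hx
    simp only [map_add, map_one, map_pow, MvPolynomial.aeval_X]
    positivity
  · simp only [map_add, map_one, map_pow, MvPolynomial.aeval_X]

/-! ## The stub -/

/-- **Registered stub `stub_eulerRationalise`** (line `dirichlet-companion-to-pi` of crux
stmt-KontsevichZagierPeriods-13633): the rationalising substitution `x = s^q/(1+s^q)` of the lower
half of Euler's reflection integral is one rule-(2) move,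
`[(0,1/2), x^{p/q-1}(1-x)^{-p/q}] ∼ [(0,1), q s^{p-1}/(1+s^q)]` (`0 < p < q`); hence any two
representations `H`, `G` with the displayed domains and integrands are `KZ.Equivalent` (source
`G`, chart `Φ(s) = s^q/(1+s^q)` with `|det DΦ| = q s^{q-1}/(1+s^q)²`, image `H`, pull-back
identity `ratz_kernel_identity`; then symmetry). [cite: KontsevichZagier2001, §1.2 rule (2)] -/
theorem stub_eulerRationalise : ∀ (p q : ℕ), 0 < p → p < q →
    ∀ (H G : Literature.NumberTheory.Transcendental.KZ.IntegralRep 1),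
    H.domain = {x | x 0 ∈ Set.Ioo (0:ℝ) (1/2)} →
    Set.EqOn H.integrand (fun x => (x 0) ^ ((p:ℝ) / q - 1) * (1 - x 0) ^ (-((p:ℝ) / q))) H.domain →
    G.domain = {x | x 0 ∈ Set.Ioo (0:ℝ) 1} →
    Set.EqOn G.integrand (fun x => (q:ℝ) * (x 0) ^ (p - 1) / (1 + (x 0) ^ q)) G.domain →
    Literature.NumberTheory.Transcendental.KZ.Equivalent H G := by
  intro p q hp hpq H G hHd hHi hGd hGi
  have hq : 0 < q := lt_trans hp hpq
  have hpos : ∀ x ∈ G.domain, 0 < x 0 := fun x hx => by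
    rw [hGd] at hx
    exact hx.1
  -- the chart maps `G.domain = (0,1)` onto `H.domain = (0,1/2)`
  have himage : H.domain =
      (fun y : Fin 1 → ℝ => fun _ : Fin 1 => (y 0) ^ q / (1 + (y 0) ^ q)) '' G.domain := by
    rw [hGd, ratz_image_chart hq, hHd]
  refine Equivalent.symm (changeOfVariablesRel_subset_relations
    ⟨1, G, H, fun y : Fin 1 → ℝ => fun _ : Fin 1 => (y 0) ^ q / (1 + (y 0) ^ q),
      fun y : Fin 1 → ℝ => ((q:ℝ) * (y 0) ^ (q - 1) / (1 + (y 0) ^ q) ^ 2) •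
        ContinuousLinearMap.id ℝ (Fin 1 → ℝ),
      ratz_isSemialgebraicMapOn_chart q G.isSemialgebraic_domain fun x hx => (hpos x hx).le,
      fun x hx => (ratz_hasFDerivAt_chart q (hpos x hx).le).hasFDerivWithinAt, ?_, himage,
      fun x hx => ?_, rfl⟩)
  · rw [hGd]
    exact ratz_injOn_chart hq
  · -- the pull-back identity on `(0,1)`, Jacobian `|det DΦ| = q s^{q-1}/(1+s^q)²` included
    have hΦx : (fun y : Fin 1 → ℝ => fun _ : Fin 1 => (y 0) ^ q / (1 + (y 0) ^ q)) x ∈ H.domain :=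
      himage ▸ mem_image_of_mem _ hx
    have h0 : 0 < x 0 := hpos x hx
    have hc : 0 < (q:ℝ) * (x 0) ^ (q - 1) / (1 + (x 0) ^ q) ^ 2 := by positivity
    rw [hGi hx, hHi hΦx, ratz_abs_det_smul_id hc]
    exact (ratz_kernel_identity hp hpq h0).symm

end Summit.KontsevichZagierPeriods.KontsevichZagierPeriods.BetaCancellationLine
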